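import Summits.BirchSwinnertonDyer.BirchSwinnertonDyer.Theorems.KatoDescentTamePotSupersingularJetchevIrreducibleSwapNodeTwoGuard
import Summits.BirchSwinnertonDyer.BirchSwinnertonDyer.Theorems.KatoDescentTamePotSupersingularJetchevIrreducibleProp47OfGross37
import HarnessLib

/-!
# Route `RamifiedHeegnerPair`, crux U₁ `LeafRankOneUpperAtThree` (stmt-BirchSwinnertonDyer-26022), line `splitkolyvagin` —
# the Jetchev divisibility reading AT AN ARBITRARY TAMAGAWA CARRIER `q ∣ N_E` (multiplicative OR additive), from the
# three named print facts {Gross 1991 Prop. 3.7 (2), Poitou–Tate duality for Selmer structures, [GZ86 III (3.1)] image-free}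

HONEST FRAMING. Theorems only; helper file (`--supports stmt-BirchSwinnertonDyer-26022 --as helper`); nothing is booked,
no item is closed, BSD is not proved for any curve; CONDITIONAL on the three displayed named facts (published results typed
as `def … : Prop` in `Literature/`). Lead prover bsd-line-rhp-p2 g9, 2026-08-28.

THE OBSERVATION. Cell `bsd-potss` (k9-c4 g10/g11) proved the body of the reading S2 (= item 27492
`JetchevDivisibilityReadingS2`, Jetchev 2008 Thm. 1.4 (ii) re-read at an additive `p` with `E[p]` irreducible) from the
three named facts on every row whose Kolyvagin prime `2` (if any) sees a surjective `ρ̄_{E,p}`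
(`JetchevIrreducibleSwapAtP.rowDivisibilityIrredAddv_of_prop37_2_of_poitouTate_of_Gross1991`). That statement carries
five binders about the carrier and the local data — `0 ≤ v_p(j)`, `p ∤ c_p`, «every Tamagawa-`p` carrier is
multiplicative», `q ∥ N` (i.e. `¬ q² ∣ N`) and `q ≠ p` — which its kernel proof NEVER USES: the Thm. 6.3 clause
(`JetchevIrreducibleReadingThm52Gross1991.h63IRowObjectsAddv_of_poitouTate_of_GZ31g_of_prop47P2`) introduces them as `_`
and works at the split carrier place `v₀ ∣ q` with the row data of `JET.carrierRowData_of_split` (any reduction type),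
`JET.kodairaNeron_isAddCyclic_forall` (the `p`-part of EVERY Kodaira–Néron component group is cyclic for odd `p`) and
the receptacle schema of [GZ86 III (3.1)] at EVERY bad place of `K`. This is Jetchev's own generality: his Thm. 1.4 is
`max_{q ∣ N} ord_p c_q`, additive carriers (Kodaira IV, IV*: `c_q = 3`) included [cite: Jetchev2008, Thm. 1.4 (ii) and
Cor. 1.5 (p. 812); proof of Thm. 1.4, p. 824]. THIS FILE records the reading in that generality, in the kernel:

* §1 `tamagawaExponent_le_mInf_anyCarrier_of_namedFacts` — the Thm. 6.3 clause at ONE core vertex for ANY prime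
  `q ∣ N_E`: `ord_p c_q(E) ≤ m_∞` (potss's node proof byte-for-byte, the five idle binders deleted, `h47P2` / `hGZg` fed
  by name from `GrossLMS1991.prop37_2_frobeniusCongruence` / `Gross1991_heegnerPoint_sub_ratTorsion_mem_E0_imageFree`).
* §2 `rowDivisibilityAnyCarrier_of_namedFacts` — THE ANY-CARRIER READING R: for `E/ℚ` non-CM globally minimal, `K`
  imaginary quadratic with `d_K ∉ {−3, −4}` and Heegner for `N_E`, `p` odd ADDITIVE (`Addv`), `E[p]` irreducible, the
  row guard «`2` Zhang–Kolyvagin ⇒ `ρ̄_{E,p}` onto», a frame `(Dt, β, ι)` whose conductor-`1` derived point is non-torsion,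
  and ANY prime `q ∣ N_E`: every derived Heegner point `P_n` (Kolyvagin primes of index `≥ s`) is `p^s`-divisible in
  `E(K[n])` for all `s ≤ ord_p c_q(E)` (assembly = potss's `…SwapNodeTwoGuard` §1–§2 with §1 of this file as the
  Thm. 6.3 clause).
* §3 `anyCarrierTwoSplitReading_of_namedFacts` — R|₂: the same in a Heegner field in which `2` SPLITS (guard idle), in
  this route's binder order; `twoSplitReading_of_anyCarrierTwoSplitReading` — R|₂ ⟹ S2|₂ (the five binders re-adjoined
  and ignored), so p638868/p639230 are instances.

WHAT IT BUYS (sequel `…LeafRankOneUpperAtThreeMonoCarrierAny.lean`): the U-compositions' reading-grade rows become the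
MONO-CARRIER rows of ANY reduction type (one prime `q ∣ N_E` carrying the whole `3`-part of `∏ c_ℓ`), so the research
residue Σ★″ (item 27493) is needed only OFF those rows — the single-ADDITIVE-carrier classes (census: 9 of the 355
rank-one Gss2 classes; 108 single-carrier = 99 mono-multiplicative + 9) leave the residue. The multi-carrier rows (238)
are untouched (Jetchev-max method barrier, S2-EXIT-g8.md §4).

References: [cite: Jetchev2008, Thm. 1.4 (ii), Cor. 1.5, proof p. 824, Prop. 4.7, Prop. 4.9, Prop. 5.3, Thm. 5.2, Rem. 6.2]
[cite: GrossLMS1991, §1 p. 235, §3 (3.3), Prop. 3.7 (2) (p. 240), §6 p. 245] [cite: GrossZagier1986, III (3.1)]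
[cite: MilneADT2006, Ch. I, Thm. 4.10(b)] [cite: McCallumLMS1991, §4 Prop. 4.4, §5 Prop. 5.2 (pp. 304–306)]
[cite: SilvermanATAEC1994, Cor. IV.9.2 (d)] [cite: Howard2004HeegnerKolyvagin, Prop. 2.1.9 (ii), Lemma 2.7.3].
presearch: «Jetchev global divisibility additive Tamagawa carrier» → [corpus: Jetchev2008 Thm. 1.4] max over all q ∣ N
(read by g8, S2-EXIT-g8.md §4); tree `lean search 'anyCarrier|AnyCarrier'` → none; nothing to cite beyond the node's sources.
-/

set_option autoImplicit false
-- the Theorems directory repeats the summit name (sibling precedent `KatoDescentPotSupersingularAssembly.lean`)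
set_option linter.dupNamespace false

noncomputable section

open scoped Classical NumberField Pointwise

open WeierstrassCurve IsDedekindDomain NumberField Field Literature.NumberTheory.EllipticCurves
  Literature.NumberTheory.EllipticCurves.ModularForms Literature.NumberTheory.EllipticCurves.Jetchev2008
  Literature.NumberTheory.EllipticCurves.Rank1Residual
  Literature.NumberTheory.GaloisRepresentations Literature.NumberTheory.GaloisCohomology
  Literature.NumberTheory.GaloisRepresentations.DiscreteGaloisModule Literature.NumberTheory.Automorphic
  Summit.BirchSwinnertonDyer.Rank1Residual Summit.BirchSwinnertonDyer.Rank1Residual.X11b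
  Summit.BirchSwinnertonDyer.Rank1Residual.X11b.Three
  Summit.BirchSwinnertonDyer.Rank1Residual.JET Summit.BirchSwinnertonDyer.Rank1Residual.JET.SelmerVocabulary
  Summit.BirchSwinnertonDyer.BirchSwinnertonDyer.Theorems
  Summit.BirchSwinnertonDyer.BirchSwinnertonDyer.Theorems.JetchevIrreducibleH63P2
  Summit.BirchSwinnertonDyer.BirchSwinnertonDyer.Theorems.JetchevIrreducibleCoreVertex
  Summit.BirchSwinnertonDyer.BirchSwinnertonDyer.Theorems.JetchevIrreducibleSwapAtP

namespace Summit.BirchSwinnertonDyer.BirchSwinnertonDyer.Theorems.JetchevReadingAnyCarrier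

/-! ## §1 The Thm. 6.3 clause at one core vertex, ANY carrier `q ∣ N_E` -/

/-- **[J] Thm. 6.3 for the row objects at ONE core vertex, carrier ANY prime `q ∣ N_E`**: `ord_p c_q(E) ≤ m_∞`, from the
three named facts. Statement = the body of `Sig.H63IRowObjectsAddv` (crux 20165) at one frame with the binders
`0 ≤ v_p(j)`, `p ∤ c_p`, «all carriers multiplicative», `¬ q² ∣ N`, `q ≠ p` (and the idle `d₁`, `m_∞ ≤ m(c)`, Kolyvagin
exhaustion) DELETED and `Addv` weakened to `p ∣ N_E`; proof = potss k9-c4 g10's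
`h63IRowObjectsAddv_of_poitouTate_of_GZ31g_of_prop47P2` byte-for-byte (it never used them): split carrier place `v₀ ∣ q`,
row data transported (`carrierRowData_of_split`), `Φ_q(p)` cyclic for every Kodaira type (`kodairaNeron_isAddCyclic_forall`),
then `tamagawaExponent_le_mInfty_of_localFacts_of_irreducible_namedPrint_of_prop47P2`. CONDITIONAL on the three facts.
[cite: Jetchev2008, Thm. 5.2 (p. 821), Thm. 1.4, Prop. 4.7, Prop. 4.9] [cite: GrossLMS1991, §1 p. 235, Prop. 3.7 (2), §6 p. 245]
[cite: SilvermanATAEC1994, Cor. IV.9.2 (d)] [cite: MilneADT2006, Ch. I, Thm. 4.10(b)] -/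
theorem tamagawaExponent_le_mInf_anyCarrier_of_namedFacts
    (h37 : GrossLMS1991.prop37_2_frobeniusCongruence)
    (hPT : ∀ (K : Type) [Field K] [NumberField K], poitouTate_selmerStructure_duality_conj K)
    (hF1 : Gross1991_heegnerPoint_sub_ratTorsion_mem_E0_imageFree)
    (W : WeierstrassCurve ℚ) [W.IsElliptic] [W.IsGloballyMinimal] [NeZero (W.conductorNorm ℤ)]
    (hcm : ¬ W.HasCM) (K : Type) [Field K] [NumberField K] (hK : IsImaginaryQuadratic K)
    (hD3 : NumberField.discr K ≠ -3) (hD4 : NumberField.discr K ≠ -4)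
    (hH : SatisfiesHeegnerHypothesis (W.conductorNorm ℤ) K) (τ : K ≃ₐ[ℚ] K) (hτ : τ ≠ 1)
    (p : ℕ) [Fact p.Prime] (hp2 : p ≠ 2) (hirr : W.HasIrreducibleModPGaloisRep p)
    (hpN : p ∣ W.conductorNorm ℤ)
    (Dt : ModularParametrizationData W (W.conductorNorm ℤ)) (β : ℤ) (ι : K →+* ℂ)
    [∀ k : ℕ, NumberField (ringClassField K ι k)]
    (q : ℕ) [Fact q.Prime] (hq : q ∣ W.conductorNorm ℤ)
    (mdiv m : {c : ℕ // Squarefree c ∧ ∀ ℓ ∈ c.primeFactors,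
        Zhang2014.IsKolyvaginPrime (W.conductorNorm ℤ) W K p ℓ} → ℕ∞)
    (hmdiv : ∀ c (u : ℕ), (u : ℕ∞) ≤ mdiv c ↔ ∀ d : KolyvaginHeegnerData Dt β ι c.1,
      ∃ Q : (W.baseChange (ringClassField K ι c.1)).toAffine.Point,
        ((p ^ u : ℕ) : ℤ) • Q = d.derivedPoint)
    (hm : ∀ c, m c = if mdiv c < Zhang2014.levelIndex W p c.1 then mdiv c else ⊤)
    (mInf k : ℕ) (c : {c : ℕ // Squarefree c ∧ ∀ ℓ ∈ c.primeFactors,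
        Zhang2014.IsKolyvaginPrime (W.conductorNorm ℤ) W K p ℓ})
    (hk : 1 ≤ k) (hcore : Jetchev2008.IsGlobalCoreVertex W K ι τ p k c.1) (hmc : m c = mInf)
    (hkM : (k : ℕ∞) + mInf ≤ Zhang2014.levelIndex W p c.1)
    (htk : padicValNat p ((W.baseChange ℚ_[q]).localTamagawaNumber ℤ_[q]) < k) (hik : mInf < k) :
    padicValNat p ((W.baseChange ℚ_[q]).localTamagawaNumber ℤ_[q]) ≤ mInf := by
  have h47P2 := JetchevIrreducibleProp44.h47P2_of_prop37_2 h37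
  have hGZg := HeegnerE0ImageFree.forall_hGZ_of_Gross1991_imageFree hF1
  have hp : p.Prime := Fact.out
  have hD : NumberField.discr K < -4 := KolyvaginAssembly.discr_lt_neg_four hK ⟨hD3, hD4⟩
  -- trivial case: `p ∤ c_q`
  by_cases ht0 : padicValNat p ((W.baseChange ℚ_[q]).localTamagawaNumber ℤ_[q]) = 0
  · rw [ht0]; exact Nat.zero_le _
  have hdvd : p ∣ (W.baseChange ℚ_[q]).localTamagawaNumber ℤ_[q] :=
    dvd_of_one_le_padicValNat (Nat.one_le_iff_ne_zero.mpr ht0)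
  -- the carrier place `v₀ ∣ q`, split, and the transport of the row data
  obtain ⟨v₀, hv₀, hv₀N, hqv₀⟩ := exists_split_place_of_dvd K hK τ hτ hH q hq
  obtain ⟨hminK, hminP, hcEq, hc0, hcyc⟩ := carrierRowData_of_split W K q hK τ v₀ hv₀ hqv₀
  haveI := hminK
  haveI := hminP
  haveI := hcyc (kodairaNeron_isAddCyclic_forall W q p hp2 hdvd)
  -- `τ² = 1`
  haveI : Algebra.IsQuadraticExtension ℚ K := ⟨hK.1⟩
  have hτ2 : τ * τ = 1 := by
    have hcard : Nat.card (K ≃ₐ[ℚ] K) = 2 := by rw [IsGalois.card_aut_eq_finrank, hK.1]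
    obtain ⟨y, -, hyu⟩ := (Nat.card_eq_two_iff' (1 : K ≃ₐ[ℚ] K)).mp hcard
    have h1 : τ = y := hyu τ hτ
    have h2 : τ⁻¹ = y := hyu τ⁻¹ (inv_ne_one.mpr hτ)
    rw [mul_eq_one_iff_eq_inv]
    exact h1.trans h2.symm
  -- instances at level `p^k`
  haveI : NeZero (p ^ k) := ⟨pow_ne_zero k hp.ne_zero⟩
  haveI : Finite (geomTorsion (W.baseChange K) ((p ^ k : ℕ) : ℤ)) :=
    finite_geomTorsion_of_neZero (W.baseChange K) (p ^ k)
  have hn : ((p ^ k : ℕ) : ℤ) ≠ 0 := by exact_mod_cast pow_ne_zero k hp.ne_zero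
  -- the named-print schemas at this frame
  obtain ⟨n', hcop', hGZ'⟩ := hGZg W K hK hD3 hD4 hH p hp2 hirr Dt β ι
  -- Kolyvagin data of the core vertex
  have hc0' : c.1 ≠ 0 := c.2.1.ne_zero
  have hkc : (k : ℕ∞) ≤ Zhang2014.levelIndex W p c.1 := le_trans le_self_add hkM
  have hcK : ∀ ℓ ∈ c.1.primeFactors, Zhang2014.IsKolyvaginPrime (W.conductorNorm ℤ) W K p ℓ ∧
      k ≤ Zhang2014.kolyvaginIndex W p ℓ := fun ℓ hℓ ↦
    ⟨c.2.2 ℓ hℓ, Zhang2014.natCast_le_levelIndex_iff.mp hkc ℓ hℓ⟩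
  -- the exponent over `K_{v₀}` is the exponent over `ℚ_q`
  have hfac : (((W.baseChange K).baseChange (v₀.adicCompletion K)).localTamagawaNumber
      (v₀.adicCompletionIntegers K)).factorization p =
      padicValNat p ((W.baseChange ℚ_[q]).localTamagawaNumber ℤ_[q]) := by
    rw [hcEq, Nat.factorization_def _ hp]
  have htk' : (((W.baseChange K).baseChange (v₀.adicCompletion K)).localTamagawaNumber
      (v₀.adicCompletionIntegers K)).factorization p < k := by rw [hfac]; exact htk
  -- the intrinsic transverse family (for `h49tr` from `htr` at level `cℓ`)
  obtain ⟨𝒯, h𝒯, hT⟩ := exists_localTransverseFamily W ι ((p ^ k : ℕ) : ℤ) hc0'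
  have key := tamagawaExponent_le_mInfty_of_localFacts_of_irreducible_namedPrint_of_prop47P2 h47P2 W
    hcm K hK hD3 hD4 hH
    (hPT K) p hp2 hirr hpN Dt β ι τ hτ hτ2 hcop' hGZ' mdiv m hmdiv hm k hn c hk hcore mInf hmc hkM hik
    v₀ hv₀ hv₀N hc0 htk'
    (fun 𝒯' h𝒯' ↦ conjActPlace_mem_transverseFamily_forall W K hK ι τ hτ p k hp2 c.1 c.2.1 hcK 𝒯' h𝒯')
    (fun 𝒯' h𝒯' e hμ hadd₁ hadd₂ hgal halt hnondeg ↦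
      RingClassTransverse.localTransverseFamily_selfDual_forall W K hK hD3 hD4 ι p k hp2 c.1 c.2.1 hcK 𝒯' h𝒯'
        e hμ hadd₁ hadd₂ hgal halt hnondeg)
    (fun ℓ h1 h2 _ v hv hfix s hs ↦
      kolyvaginLocalTerm_of_poitouTate hPT W K hK τ hτ p k hp2 hk ℓ h1 h2 v hv hfix s hs)
    (fun d ℓ hℓ ↦ kolyvaginClass_mem_transverseKer W hK hD hp2 Dt β ι k c.2.1 hcK d hℓ)
    (fun ℓ h1 h2 h3 d' w hw ↦ by
      -- `h49tr` from `htr` at level `cℓ` through the reconciliation `hT`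
      have hl : ℓ.Prime := h1.1
      have hlc : ¬ ℓ ∣ c.1 := fun h ↦ h3 (Nat.mem_primeFactors.mpr ⟨hl, h, hc0'⟩)
      have hcl : Squarefree (c.1 * ℓ) :=
        (Nat.squarefree_mul ((Nat.Prime.coprime_iff_not_dvd hl).mpr hlc).symm).mpr ⟨c.2.1, hl.squarefree⟩
      have hpf : (c.1 * ℓ).primeFactors = c.1.primeFactors ∪ {ℓ} := by
        rw [Nat.primeFactors_mul hc0' hl.ne_zero, hl.primeFactors]
      have hcKℓ : ∀ l' ∈ (c.1 * ℓ).primeFactors, Zhang2014.IsKolyvaginPrime (W.conductorNorm ℤ) W K p l' ∧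
          k ≤ Zhang2014.kolyvaginIndex W p l' := by
        intro l' hl'
        rw [hpf, Finset.mem_union, Finset.mem_singleton] at hl'
        rcases hl' with h | rfl
        · exact hcK l' h
        · exact ⟨h1, h2⟩
      rw [← h𝒯 w]
      refine (hT _).mpr (fun l' hl' ↦ ?_) w hw
      exact kolyvaginClass_mem_transverseKer W hK hD hp2 Dt β ι k hcl hcKℓ d'
        (by rw [hpf]; exact Finset.mem_union_left _ hl'))
  rw [hfac] at key
  exact key

/-! ## §2 The any-carrier reading R at one frame, from the three named facts and the row guard -/

/-- **THE ANY-CARRIER READING R** (Jetchev 2008 Thm. 1.4 (ii) in its printed generality `q ∣ N`, re-read at an additive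
`p` with `E[p]` irreducible): for `E/ℚ` non-CM globally minimal, `K` imaginary quadratic with `d_K ∉ {−3, −4}` and the
Heegner hypothesis for `N_E`, `p ≠ 2` with `E` additive at `p`, `E[p]` irreducible, the row guard «`2` Zhang–Kolyvagin
for `(E, K, p)` ⇒ `ρ̄_{E,p}` onto», a frame `(Dt, β, ι)` with non-torsion conductor-`1` derived point, and ANY prime
`q ∣ N_E` (multiplicative or additive, `q = p` allowed): every derived Heegner point `P_n` (Kolyvagin primes of index `≥ s`)
is `p^s`-divisible in `E(K[n])` for all `s ≤ ord_p c_q(E)`. Assembly = potss's `…SwapNodeTwoGuard` §1/§2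
(level raising at minimal depth `levelRaising_of_h47row_of_poitouTate_of_GZ31_of_irreducible`, core vertices
`coreVertexExistenceIrredP_lt_of_prop47P2_of_poitouTate_of_GZ31g`, bridge `JET.derivedPoint_divisible_of_levelRaising_of_section6_min`)
with §1 as the Thm. 6.3 clause. NO `q ∥ N`, NO «carriers multiplicative», NO `q ≠ p`, NO `p ∤ c_p`, NO `v_p(j) ≥ 0`.
CONDITIONAL on the three facts; nothing asserted about any curve. [cite: Jetchev2008, Thm. 1.4 (ii), proof p. 824, Prop. 5.3, Thm. 5.2]
[cite: GrossLMS1991, Prop. 3.7 (2)] [cite: GrossZagier1986, III (3.1)] [cite: MilneADT2006, Ch. I, Thm. 4.10(b)]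
[cite: McCallumLMS1991, §5 proof of Prop. 5.2 (pp. 305–306)] -/
theorem rowDivisibilityAnyCarrier_of_namedFacts
    (h37 : GrossLMS1991.prop37_2_frobeniusCongruence)
    (hPT : ∀ (K : Type) [Field K] [NumberField K], poitouTate_selmerStructure_duality_conj K)
    (hF1 : Gross1991_heegnerPoint_sub_ratTorsion_mem_E0_imageFree)
    (W : WeierstrassCurve ℚ) [W.IsElliptic] [W.IsGloballyMinimal] [NeZero (W.conductorNorm ℤ)]
    (hcm : ¬ W.HasCM) (K : Type) [Field K] [NumberField K] (hK : IsImaginaryQuadratic K)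
    (hD3 : NumberField.discr K ≠ -3) (hD4 : NumberField.discr K ≠ -4)
    (hH : SatisfiesHeegnerHypothesis (W.conductorNorm ℤ) K)
    (p : ℕ) [Fact p.Prime] (hp2 : p ≠ 2) (hadd : Addv W p) (hirr : W.HasIrreducibleModPGaloisRep p)
    (hR : Zhang2014.IsKolyvaginPrime (W.conductorNorm ℤ) W K p 2 → W.HasSurjectiveModNGaloisRep p)
    (Dt : ModularParametrizationData W (W.conductorNorm ℤ)) (β : ℤ) (ι : K →+* ℂ)
    (d₁ : KolyvaginHeegnerData Dt β ι 1) (hy : ¬ IsOfFinAddOrder d₁.derivedPoint)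
    (q : ℕ) [Fact q.Prime] (hqN : q ∣ W.conductorNorm ℤ) :
    ∀ (s : ℕ), s ≤ padicValNat p ((W.baseChange ℚ_[q]).localTamagawaNumber ℤ_[q]) →
      ∀ (n : ℕ) (d : KolyvaginHeegnerData Dt β ι n), Squarefree n →
        (∀ ℓ ∈ n.primeFactors, Zhang2014.IsKolyvaginPrime (W.conductorNorm ℤ) W K p ℓ ∧
          s ≤ Zhang2014.kolyvaginIndex W p ℓ) →
        ∃ Q : (W.baseChange (ringClassField K ι n)).toAffine.Point,
          ((p ^ s : ℕ) : ℤ) • Q = d.derivedPoint := by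
  intro s hs n d hn hℓ
  have hpN : p ∣ W.conductorNorm ℤ := (W.dvd_conductorNorm_iff_not_hasGoodReductionAtPrime p).mpr hadd.1
  obtain ⟨τ, hτ⟩ := exists_algEquiv_ne_one_of_isImaginaryQuadratic K hK
  haveI : ∀ k : ℕ, NumberField (ringClassField K ι k) := fun k ↦
    Summit.BirchSwinnertonDyer.Rank1Residual.JET.numberField_ringClassField K hK ι k
  have h47PG := h47PG_of_prop37_2 h37
  have h47P2 := JetchevIrreducibleProp44.h47P2_of_prop37_2 h37
  have hGZg := HeegnerE0ImageFree.forall_hGZ_of_Gross1991_imageFree hF1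
  -- [GZ86 III (3.1)] at this frame; level raising at minimal depth, guard `(· ≠ 2 ∨ ρ̄_p onto)`
  obtain ⟨n', hcop', hGZ'⟩ := hGZg W K hK hD3 hD4 hH p hp2 hirr Dt β ι
  have hraise := JetchevIrreducibleSwap.levelRaising_of_h47row_of_poitouTate_of_GZ31_of_irreducible W hK hD3 hD4 hH
    hcm τ hτ p hp2 hirr hpN Dt β ι (fun ℓ ↦ ℓ ≠ 2 ∨ W.HasSurjectiveModNGaloisRep p) (swapGuardOnto_of hR)
    (addOrderOf_localization_kolyvaginClass_eq_of_h47PG h47PG W hcm K hK hD3 hD4 hH p hp2 hirr hpN Dt β ι)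
    (hPT K) hcop' hGZ'
  -- Jetchev Prop. 5.3 (core vertices) in the `s < m` form, from the three facts
  have hCVIlt := coreVertexExistenceIrredP_lt_of_prop47P2_of_poitouTate_of_GZ31g h47P2 hPT hGZg
  -- the image-free §6 bridge, target exponent `t := ord_p c_q(E)`
  refine derivedPoint_divisible_of_levelRaising_of_section6_min W K p Dt β ι
    (padicValNat p ((W.baseChange ℚ_[q]).localTamagawaNumber ℤ_[q])) hraise ?_ s hs n d hn hℓ
  intro mdiv m hchar hmdef mInf hmInf hKoly
  exact ⟨fun k c ↦ mInf < k → Jetchev2008.IsGlobalCoreVertex W K ι τ p k c.1,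
    fun k c hk hmc hMc ↦ by
      by_cases hik : mInf < k
      · obtain ⟨c', hcore, hM', hm'⟩ := exists_coreVertex_of_coreVertexExistenceIrredPlt hCVIlt W hcm K hK hD3
          hD4 hH τ hτ p hp2 hirr hpN Dt β ι d₁ hy mdiv m hchar hmdef mInf k c hk hmc hMc hik
        exact ⟨c', fun _ ↦ hcore, hM', hm'⟩
      · exact ⟨c, fun h ↦ absurd h hik, by rw [add_comm]; exact hMc, le_of_eq hmc⟩,
    fun k c hk hcore hmc hMc htk hik ↦ tamagawaExponent_le_mInf_anyCarrier_of_namedFacts h37 hPT hF1 W hcm K hK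
      hD3 hD4 hH τ hτ p hp2 hirr hpN Dt β ι q hqN mdiv m hchar hmdef mInf k c hk (hcore hik) hmc hMc htk hik⟩

/-! ## §3 R|₂: the any-carrier reading in a Heegner field in which `2` splits; R|₂ ⟹ S2|₂ -/

/-- **R|₂ — the any-carrier reading in a Heegner field in which `2` SPLITS**, from the three named facts ONLY (in such a
field `2` is not a Kolyvagin prime, `not_isKolyvaginPrime_two_of_heegnerHypothesis_two`, so §2's guard is idle). Binder
order of this route's S2|₂ (p638868 `twoSplitReading_of_namedFacts`) with the five idle binders gone and the carrier any
prime `q ∣ N_E`. CONDITIONAL on the three facts; nothing asserted. [cite: Jetchev2008, Thm. 1.4 (ii) (p. 812)]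
[cite: GrossLMS1991, Prop. 3.7 (2)] [cite: GrossZagier1986, III (3.1)] [cite: MilneADT2006, Ch. I, Thm. 4.10(b)] -/
theorem anyCarrierTwoSplitReading_of_namedFacts
    (h37 : GrossLMS1991.prop37_2_frobeniusCongruence)
    (hPT : ∀ (K : Type) [Field K] [NumberField K], poitouTate_selmerStructure_duality_conj K)
    (hF1 : Gross1991_heegnerPoint_sub_ratTorsion_mem_E0_imageFree) :
    ∀ (W : WeierstrassCurve ℚ) [W.IsElliptic] [W.IsGloballyMinimal] [NeZero (W.conductorNorm ℤ)],
      ¬ W.HasCM →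
      ∀ (K : Type) [Field K] [NumberField K], IsImaginaryQuadratic K →
      NumberField.discr K ≠ -3 → NumberField.discr K ≠ -4 →
      SatisfiesHeegnerHypothesis (W.conductorNorm ℤ) K → SatisfiesHeegnerHypothesis 2 K →
      ∀ (p : ℕ) [Fact p.Prime], p ≠ 2 → Addv W p → W.HasIrreducibleModPGaloisRep p →
      ∀ (Dt : ModularParametrizationData W (W.conductorNorm ℤ)) (β : ℤ) (ι : K →+* ℂ)
        (d₁ : KolyvaginHeegnerData Dt β ι 1), ¬ IsOfFinAddOrder d₁.derivedPoint →
      ∀ (q : ℕ) [Fact q.Prime], q ∣ W.conductorNorm ℤ →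
      ∀ (s : ℕ), s ≤ padicValNat p ((W.baseChange ℚ_[q]).localTamagawaNumber ℤ_[q]) →
        ∀ (n : ℕ) (d : KolyvaginHeegnerData Dt β ι n), Squarefree n →
          (∀ ℓ ∈ n.primeFactors, Zhang2014.IsKolyvaginPrime (W.conductorNorm ℤ) W K p ℓ ∧
            s ≤ Zhang2014.kolyvaginIndex W p ℓ) →
          ∃ Q : (W.baseChange (ringClassField K ι n)).toAffine.Point,
            ((p ^ s : ℕ) : ℤ) • Q = d.derivedPoint :=
  fun W _ _ _ hcm K _ _ hK hD3 hD4 hH h2K p _ hp2 hadd hirr Dt β ι d₁ hy q _ hqN ↦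
    rowDivisibilityAnyCarrier_of_namedFacts h37 hPT hF1 W hcm K hK hD3 hD4 hH p hp2 hadd hirr
      (fun h2 ↦ absurd h2 (not_isKolyvaginPrime_two_of_heegnerHypothesis_two h2K)) Dt β ι d₁ hy q hqN

/-- **R|₂ ⟹ S2|₂** (the 2-split reading of p638868, `bsd-potss`'s S2 binder list + «`2` splits in `K`», VERBATIM): the
five binders `0 ≤ v_p(j)`, `p ∤ c_p`, «carriers multiplicative», `¬ q² ∣ N`, `q ≠ p` are re-adjoined and ignored. So every
composition of record over S2|₂ is an instance of one over R|₂. Pure bookkeeping. [cite: Jetchev2008, Thm. 1.4 (ii)] -/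
theorem twoSplitReading_of_anyCarrierTwoSplitReading
    (hR : ∀ (W : WeierstrassCurve ℚ) [W.IsElliptic] [W.IsGloballyMinimal] [NeZero (W.conductorNorm ℤ)],
      ¬ W.HasCM →
      ∀ (K : Type) [Field K] [NumberField K], IsImaginaryQuadratic K →
      NumberField.discr K ≠ -3 → NumberField.discr K ≠ -4 →
      SatisfiesHeegnerHypothesis (W.conductorNorm ℤ) K → SatisfiesHeegnerHypothesis 2 K →
      ∀ (p : ℕ) [Fact p.Prime], p ≠ 2 → Addv W p → W.HasIrreducibleModPGaloisRep p →
      ∀ (Dt : ModularParametrizationData W (W.conductorNorm ℤ)) (β : ℤ) (ι : K →+* ℂ)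
        (d₁ : KolyvaginHeegnerData Dt β ι 1), ¬ IsOfFinAddOrder d₁.derivedPoint →
      ∀ (q : ℕ) [Fact q.Prime], q ∣ W.conductorNorm ℤ →
      ∀ (s : ℕ), s ≤ padicValNat p ((W.baseChange ℚ_[q]).localTamagawaNumber ℤ_[q]) →
        ∀ (n : ℕ) (d : KolyvaginHeegnerData Dt β ι n), Squarefree n →
          (∀ ℓ ∈ n.primeFactors, Zhang2014.IsKolyvaginPrime (W.conductorNorm ℤ) W K p ℓ ∧
            s ≤ Zhang2014.kolyvaginIndex W p ℓ) →
          ∃ Q : (W.baseChange (ringClassField K ι n)).toAffine.Point,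
            ((p ^ s : ℕ) : ℤ) • Q = d.derivedPoint) :
    ∀ (W : WeierstrassCurve ℚ) [W.IsElliptic] [W.IsGloballyMinimal] [NeZero (W.conductorNorm ℤ)],
      ¬ W.HasCM →
      ∀ (K : Type) [Field K] [NumberField K], IsImaginaryQuadratic K →
      NumberField.discr K ≠ -3 → NumberField.discr K ≠ -4 →
      SatisfiesHeegnerHypothesis (W.conductorNorm ℤ) K → SatisfiesHeegnerHypothesis 2 K →
      ∀ (p : ℕ) [Fact p.Prime], p ≠ 2 → Addv W p → 0 ≤ padicValRat p W.j →
      W.HasIrreducibleModPGaloisRep p →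
      ¬ p ∣ (W.baseChange ℚ_[p]).localTamagawaNumber ℤ_[p] →
      (∀ (q' : ℕ) [Fact q'.Prime], q' ∣ W.conductorNorm ℤ →
        p ∣ (W.baseChange ℚ_[q']).localTamagawaNumber ℤ_[q'] → ¬ q' ^ 2 ∣ W.conductorNorm ℤ) →
      ∀ (Dt : ModularParametrizationData W (W.conductorNorm ℤ)) (β : ℤ) (ι : K →+* ℂ)
        (d₁ : KolyvaginHeegnerData Dt β ι 1), ¬ IsOfFinAddOrder d₁.derivedPoint →
      ∀ (q : ℕ) [Fact q.Prime], q ∣ W.conductorNorm ℤ → ¬ q ^ 2 ∣ W.conductorNorm ℤ → q ≠ p →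
      ∀ (s : ℕ), s ≤ padicValNat p ((W.baseChange ℚ_[q]).localTamagawaNumber ℤ_[q]) →
        ∀ (n : ℕ) (d : KolyvaginHeegnerData Dt β ι n), Squarefree n →
          (∀ ℓ ∈ n.primeFactors, Zhang2014.IsKolyvaginPrime (W.conductorNorm ℤ) W K p ℓ ∧
            s ≤ Zhang2014.kolyvaginIndex W p ℓ) →
          ∃ Q : (W.baseChange (ringClassField K ι n)).toAffine.Point,
            ((p ^ s : ℕ) : ℤ) • Q = d.derivedPoint :=
  fun W _ _ _ hcm K _ _ hK hD3 hD4 hH h2K p _ hp2 hadd _ hirr _ _ Dt β ι d₁ hy q _ hqN _ _ ↦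
    hR W hcm K hK hD3 hD4 hH h2K p hp2 hadd hirr Dt β ι d₁ hy q hqN

end Summit.BirchSwinnertonDyer.BirchSwinnertonDyer.Theorems.JetchevReadingAnyCarrier

end
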